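/-
Copyright: the b2b-balaban T⁴-continuum CRUX team, row NE7b leaf lineage `t4-ne7b-formalise-leaf-03` (gen 146). Project licence.
-/
import Summits.QuantumFields.BalabanUV.T4Continuum.Spine.NE7b.ConstrainedValueSecondOrder
import Literature.Analysis.Convex.AlexandrovSemiconvex
import Summits.QuantumFields.BalabanUV.T4Continuum.Spine.NE7b.PeanoHessianIdentity

/-!
# THE VALUE HESSIAN IS THE CONSTRAINED SCHUR FORM: uniqueness of the second-order term of the constrained value function, its
# stability under `ρ‖·‖²`-perturbations of the form (T-85 (L3)), and the second-order envelope theorem in HESSIAN currency for a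
# twice-differentiable `V` — `φ (w₀ + h) = φ w₀ + DV(δ₀)(N h) + ½ D²V(δ₀)[N h, N h] + o(‖h‖²)`, `½ D²V(δ₀)[N ·, N ·] = ½ (D²V(δ₀))_D`
# (row NE7b, node U5c; residual (R2′) family (2), letter (ℓ1); sequel of `…ConstrainedValueSecondOrder`; Mathlib + one built Literature lemma)

Cell `pub-balaban`, sub-cell `t4`, spine estimate NE7b (`T4WeightBudget.RelWeightBound`; the cell's OWN estimate — NOT PRINTED in
[Bałaban 1983–89], NOT PROVED).  Crux-route work under `Spine/NE7b/` by a row leaf on the convexity road; NOTHING of Bałaban's is named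
or asserted; no `T4Continuum/Support` leaf typed (FREEZE (0)); no `def`; zero `sorry`.  Imports: `…ConstrainedValueSecondOrder` (this
lineage; Mathlib only) and the BUILT `Literature.Analysis.Convex.AlexandrovSemiconvex` for its Peano–Taylor lemma
`Literature.Analysis.Convex.taylor_two_isLittleO_of_hasFDerivAt`.

WHY.  `…ConstrainedValueSecondOrder` (CVS) proves, in Peano currency, that the value function `φ w = ⨅_{D δ = w} V δ` of a linearly
constrained minimum has at `w₀` a second-order expansion with quadratic term `q ∘ N = q_D`, the constrained Schur form of `V`'s own
second-order form `q` at the constrained minimiser `δ₀` (`N` a right inverse of `D` minimising `q` on fibres — CSTF §3's `M`).  THIS FILE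
draws the three consequences T-85 (idea-1 g85) asks of «the second-order half of (J1)»: (§1) a function has at most ONE 2-homogeneous
second-order term, so WHATEVER Hessian `φ` has at `w₀` (e.g. `½ D²φ(w₀)[h, h]` when `φ ∈ C²` near `w₀`) IS `q_D` — the (J1) sentence
«`D²φ = the constrained Schur complement of D²V`» with no implicit function; (§2) T-85 (L3)'s by-name place: a perturbation
`q′ ≤ q + ρ‖·‖²` of the form (print's «multiplier × curvature» insertion `−λ∘D²G`, `ρ = ‖λ‖·‖D²G‖ = O(‖J‖)`) moves the constrained Schur
form by at most `ρ‖N‖²‖h‖²` through the respective fibre-minimiser map (print's `H₁`, built from the perturbed operator); (§3) the END in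
HESSIAN currency: for `V` differentiable near `δ₀` with `HasFDerivAt V′ V″ δ₀` (or simply `ContDiffAt ℝ 2 V δ₀`) the expansion holds with
`V′ = DV(δ₀)` and `q = ½ D²V(δ₀)[·, ·]`, i.e. the value function's Hessian form is `½ (D²V(δ₀))_D` — CVS §5 fed with the tree's lemma.

WHAT IS PROVED ([folklore]; Fiacco (1983) §3.2, Bonnans–Shapiro (2000) §4.7 for the `C²` statements):
* §1 (v3: the uniqueness lemma is `PeanoHessianIdentity.eq_of_two_homogeneous_isLittleO`, imported — two 2-homogeneous `p, p′ : F → ℝ` with `(h ↦ p h − p′ h) =o[𝓝 0] ‖h‖²` are equal — scale `h` into the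
  neighbourhood) and **`secondOrderForm_constrValue_eq`** (under CVS §5's hypotheses with `q` 2-homogeneous: ANY 2-homogeneous
  second-order term `p` of `φ` at `w₀` satisfies `p h = q_D h = ⨅_{D v = h} q v`).
* §2 `constrInf_mono` (`0 ≤ q ≤ q′ ⟹ q_D ≤ q′_D`) and **`constrInf_le_constrInf_add_of_fibreMin`** (`N : F →L E` a right inverse of `D`
  minimising `q` on fibres, `0 ≤ q′ ≤ q + ρ‖·‖²`, `0 ≤ ρ` ⊢ `q′_D h ≤ q_D h + ρ‖N‖²‖h‖²`; swap the roles for the other side).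
* §3 `half_apply_apply_le` (`½ B v v ≤ (‖B‖∕2)‖v‖²`), **`isLittleO_constrValue_hessian`** (`HasFDerivAt V (V′ δ) δ` near `δ₀`,
  `HasFDerivAt V′ V″ δ₀`, `δ₀` a constrained minimiser over `w₀`, the strong first-order letter at `δ₀`, `0 ≤ V″ v v`, `N` a right inverse
  minimising `v ↦ V″ v v` on fibres ⊢ `(h ↦ φ (w₀ + h) − φ w₀ − V′ δ₀ (N h) − ½ V″ (N h) (N h)) =o[𝓝 0] ‖h‖²`) and
  **`isLittleO_constrValue_hessian_of_contDiffAt`** (`ContDiffAt ℝ 2 V δ₀` suffices: `V′ = fderiv ℝ V`, `V″ = fderiv ℝ (fderiv ℝ V) δ₀`).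

* §4 LETTERS OF THE NONLINEAR COMPANION `…ConstrainedValueLagrangian` (CVL), discharged: **`abs_apply_remainder_le`** (print's norm
  bound (135) `‖G (δ₀ + v) − G δ₀ − T v‖ ≤ C₂‖v‖²` ⊢ CVL's curvature letter with `ρ = ‖Λ‖C₂` — T-85 (L3) in print's shape) and
  **`apply_eq_apply_comp_of_firstOrderG`** (THE LAGRANGE CONDITION IS AUTOMATIC: the constraint-adapted strong letter + `HasFDerivAt V V′ δ₀`
  + `HasFDerivAt G T δ₀` ⊢ `V′ = Λ ∘ T`, by Fermat — CVL's `hlag` is implied by its other letters).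

NOT HERE (honest): `C²`-regularity of `φ` itself (implicit function); the NONLINEAR expansion itself (CVL, T-85 (L2)); which
`V`, `D` of Bałaban's ((A3) ∕ (A1c), NC-NE7b-α UNRULED); any value.  BY-NAME EFFECT ON THE WALL: NONE.  NE7b NOT PRINTED ∕ NOT PROVED;
spine PROVED 0∕9; rung (B)+1 on a FINITE torus — NOT infinite volume, NOT the mass gap, NOT Clay.  HONEST DEPENDENCY: continuum YM on T⁴ ⇐
BetaPertH ∧ nine spine estimates (0/9 proved); BetaPertH ⇐ (D1) ∧ (D4) ∧ CAP+tail; G-an2-4 gates asym, D1 and NE2∕3∕4.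
-/

set_option autoImplicit false

open Set Function Filter Asymptotics Metric
open scoped Topology
open Summit.QuantumFields.BalabanUV.T4Continuum.NE7b.ConstrainedValueSecondOrder
open Summit.QuantumFields.BalabanUV.T4Continuum.NE7b.PeanoHessianIdentity (eq_of_two_homogeneous_isLittleO)

namespace Summit.QuantumFields.BalabanUV.T4Continuum.NE7b.ConstrainedValueHessian

/-! ## §1 Uniqueness of the second-order term: whatever Hessian the value function has, it is `q_D` -/

section Unique

variable {E F : Type*} [NormedAddCommGroup E] [NormedSpace ℝ E] [NormedAddCommGroup F] [NormedSpace ℝ F]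

-- v3: §1's uniqueness lemma `eq_of_isLittleO_sq` now lives in the Mathlib∕Literature-only module `…Spine.NE7b.PeanoHessianIdentity`
-- (leaf-03 g147, p380111) as `eq_of_two_homogeneous_isLittleO` — imported and called BY NAME below (chair leaf-04 g152 ι-X-PHI-1: the
-- binder-identical twin would trip `dedup.landed` once PHI is in the tree).

/-- **WHATEVER SECOND-ORDER TERM THE VALUE FUNCTION HAS AT `w₀`, IT IS THE CONSTRAINED SCHUR FORM.**  Under the hypotheses of
`isLittleO_constrValue_secondOrder_of_isMinOn` with `q` 2-homogeneous: if `φ (w₀ + h) = φ w₀ + V′ (N h) + p h + o(‖h‖²)` for some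
2-homogeneous `p` (e.g. `p h = ½ D²φ(w₀)[h, h]` when `φ ∈ C²` near `w₀`, the linear term being the multiplier by CVD §4), then
`p h = q_D h = ⨅_{D v = h} q v` for every `h` — «the value Hessian IS the constrained Schur complement» (T-80 (J1)). [folklore] -/
theorem secondOrderForm_constrValue_eq {V q : E → ℝ} {V' : E →L[ℝ] ℝ} {D : E →L[ℝ] F} {N : F →L[ℝ] E}
    (hN : ∀ w, D (N w) = w) (hNmin : ∀ v, q (N (D v)) ≤ q v) {w₀ : F} {δ₀ : E} (hδ₀ : D δ₀ = w₀)
    (hmin : ∀ δ, D δ = w₀ → V δ₀ ≤ V δ) {m : ℝ} (hm : 0 < m) (hfo : ∀ δ, V δ₀ + V' (δ - δ₀) + m / 2 * ‖δ - δ₀‖ ^ 2 ≤ V δ)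
    (hq0 : ∀ v, 0 ≤ q v) {c : ℝ} (hqc : ∀ v, q v ≤ c * ‖v‖ ^ 2) (hq2 : ∀ (t : ℝ) (v : E), q (t • v) = t ^ 2 * q v)
    (hV2 : (fun v => V (δ₀ + v) - V δ₀ - V' v - q v) =o[𝓝 (0 : E)] fun v => ‖v‖ ^ 2)
    {p : F → ℝ} (hp2 : ∀ (t : ℝ) (h : F), p (t • h) = t ^ 2 * p h)
    (hφ2 : (fun h => (⨅ δ : {δ // D δ = w₀ + h}, V δ.1) - (⨅ δ : {δ // D δ = w₀}, V δ.1) - V' (N h) - p h)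
      =o[𝓝 (0 : F)] fun h => ‖h‖ ^ 2) (h : F) :
    p h = ⨅ v : {v // D v = h}, q v.1 := by
  rw [constrInf_eq_apply_fibreMin (D := (D : E → F)) hN hNmin h]
  have hend := isLittleO_constrValue_secondOrder_of_isMinOn hN hNmin hδ₀ hmin hm hfo hq0 hqc hV2
  have hdiff : (fun h => p h - q (N h)) =o[𝓝 (0 : F)] fun h => ‖h‖ ^ 2 := by
    refine (hend.sub hφ2).congr' (Eventually.of_forall fun h => ?_) EventuallyEq.rfl
    dsimp only
    ring
  exact eq_of_two_homogeneous_isLittleO hp2 (fun t h => by rw [map_smul, hq2]) hdiff h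

end Unique

/-! ## §2 Perturbed forms: the constrained Schur form moves by at most `ρ‖N‖²` through a fibre-minimiser map (T-85 (L3)) -/

section Mono

variable {E F : Type*}

/-- MONOTONICITY: `0 ≤ q ≤ q′` pointwise and a non-empty fibre ⟹ `q_D h ≤ q′_D h`. [folklore] -/
theorem constrInf_mono {D : E → F} {q q' : E → ℝ} (hq0 : ∀ v, 0 ≤ q v) (hle : ∀ v, q v ≤ q' v) {h : F} (hne : ∃ v, D v = h) :
    (⨅ v : {v // D v = h}, q v.1) ≤ ⨅ v : {v // D v = h}, q' v.1 := by
  obtain ⟨v₀, hv₀⟩ := hne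
  haveI : Nonempty {v // D v = h} := ⟨⟨v₀, hv₀⟩⟩
  have hb : BddBelow (range fun v : {v // D v = h} => q v.1) := ⟨0, forall_mem_range.2 fun v => hq0 v.1⟩
  exact le_ciInf fun v => (ciInf_le hb v).trans (hle v.1)

end Mono

section Perturb

variable {E F : Type*} [NormedAddCommGroup E] [NormedSpace ℝ E] [NormedAddCommGroup F] [NormedSpace ℝ F]

/-- **THE CONSTRAINED SCHUR FORM OF A PERTURBED FORM.**  `N : F →L[ℝ] E` a right inverse of `D` and a fibre-minimiser map of `q`,
`0 ≤ q′`, `q′ v ≤ q v + ρ‖v‖²` with `0 ≤ ρ` ⟹ `q′_D h ≤ q_D h + ρ‖N‖²‖h‖²` (competitor `N h`; §1).  With the roles swapped (a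
fibre-minimiser map `N′` of `q′` and `q ≤ q′ + ρ‖·‖²`) the other side `q_D ≤ q′_D + ρ‖N′‖²‖·‖²` follows: a `ρ‖·‖²`-perturbation of
the form — T-85's «multiplier × curvature» insertion `−λ∘D²G`, `ρ = ‖λ‖·‖D²G‖` — moves the value Hessian by at most `ρ` times the
squared norm of the respective minimiser map (print's `H₁`, built from the perturbed operator). [folklore] -/
theorem constrInf_le_constrInf_add_of_fibreMin {D : E →L[ℝ] F} {q q' : E → ℝ} {N : F →L[ℝ] E} (hN : ∀ w, D (N w) = w)
    (hNmin : ∀ v, q (N (D v)) ≤ q v) (hq'0 : ∀ v, 0 ≤ q' v) {ρ : ℝ} (hρ : 0 ≤ ρ) (hqq' : ∀ v, q' v ≤ q v + ρ * ‖v‖ ^ 2)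
    (h : F) : (⨅ v : {v // D v = h}, q' v.1) ≤ (⨅ v : {v // D v = h}, q v.1) + ρ * ‖N‖ ^ 2 * ‖h‖ ^ 2 := by
  rw [constrInf_eq_apply_fibreMin (D := (D : E → F)) hN hNmin h]
  have hb : BddBelow (range fun v : {v // D v = h} => q' v.1) := ⟨0, forall_mem_range.2 fun v => hq'0 v.1⟩
  have h1 : (⨅ v : {v // D v = h}, q' v.1) ≤ q' (N h) := ciInf_le hb ⟨N h, hN h⟩
  have h2 : ρ * ‖N h‖ ^ 2 ≤ ρ * ‖N‖ ^ 2 * ‖h‖ ^ 2 := by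
    rw [mul_assoc]
    exact mul_le_mul_of_nonneg_left (norm_clm_apply_sq_le N h) hρ
  linarith [hqq' (N h)]

end Perturb

/-! ## §3 THE END IN HESSIAN CURRENCY: a twice-differentiable `V` (the tree's Peano–Taylor lemma by name) -/

section Hessian

variable {E F : Type*} [NormedAddCommGroup E] [NormedSpace ℝ E] [NormedAddCommGroup F] [NormedSpace ℝ F]

/-- `½ B v v ≤ (‖B‖∕2)‖v‖²` for a continuous bilinear form. [folklore] -/
theorem half_apply_apply_le (B : E →L[ℝ] E →L[ℝ] ℝ) (v : E) : B v v / 2 ≤ ‖B‖ / 2 * ‖v‖ ^ 2 := by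
  have h1 : B v v ≤ ‖B‖ * ‖v‖ * ‖v‖ := by
    have h2 := B.le_opNorm₂ v v
    rw [Real.norm_eq_abs] at h2
    exact (le_abs_self _).trans h2
  nlinarith [h1]

/-- **THE SECOND-ORDER ENVELOPE THEOREM IN HESSIAN CURRENCY.**  `V` differentiable near `δ₀` with derivative field `V′` and
`HasFDerivAt V′ V″ δ₀` (a second derivative AT THE POINT only), `δ₀` a minimiser of `V` on the fibre `{D δ = w₀}`, the strong
first-order letter at `δ₀` (`m > 0`), `0 ≤ V″ v v`, and `N` a right inverse of `D` that is a fibre-minimiser map of the Hessian form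
`v ↦ V″ v v` (CSTF §4 `exists_constrMin` supplies one in finite dimension for `V″ > 0`) ⟹
`(h ↦ φ (w₀ + h) − φ w₀ − V′ δ₀ (N h) − ½ V″ (N h) (N h)) =o[𝓝 0] ‖h‖²`: the value function's second-order term at `w₀` is HALF THE
CONSTRAINED SCHUR FORM OF THE HESSIAN, `½ (V″)_D h = ½ ⨅_{D v = h} V″ v v` (§1) — §5 fed with the tree's Peano–Taylor lemma
`Literature.Analysis.Convex.taylor_two_isLittleO_of_hasFDerivAt`. [folklore] -/
theorem isLittleO_constrValue_hessian {V : E → ℝ} {V' : E → E →L[ℝ] ℝ} {V'' : E →L[ℝ] E →L[ℝ] ℝ} {D : E →L[ℝ] F}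
    {N : F →L[ℝ] E} (hN : ∀ w, D (N w) = w) (hNmin : ∀ v, V'' (N (D v)) (N (D v)) ≤ V'' v v) {w₀ : F} {δ₀ : E}
    (hδ₀ : D δ₀ = w₀) (hmin : ∀ δ, D δ = w₀ → V δ₀ ≤ V δ) {m : ℝ} (hm : 0 < m)
    (hfo : ∀ δ, V δ₀ + V' δ₀ (δ - δ₀) + m / 2 * ‖δ - δ₀‖ ^ 2 ≤ V δ) (hpsd : ∀ v, 0 ≤ V'' v v)
    (hV : ∀ᶠ δ in 𝓝 δ₀, HasFDerivAt V (V' δ) δ) (hV'' : HasFDerivAt V' V'' δ₀) :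
    (fun h => (⨅ δ : {δ // D δ = w₀ + h}, V δ.1) - (⨅ δ : {δ // D δ = w₀}, V δ.1) - V' δ₀ (N h) - V'' (N h) (N h) / 2)
      =o[𝓝 (0 : F)] fun h => ‖h‖ ^ 2 :=
  isLittleO_constrValue_secondOrder_of_isMinOn (q := fun v => V'' v v / 2) hN
    (fun v => by linarith [hNmin v]) hδ₀ hmin hm hfo (fun v => by linarith [hpsd v])
    (fun v => half_apply_apply_le V'' v) (Literature.Analysis.Convex.taylor_two_isLittleO_of_hasFDerivAt hV hV'')

/-- **`C²` AT THE POINT suffices**: `ContDiffAt ℝ 2 V δ₀` supplies the derivative field `fderiv ℝ V` near `δ₀` and the second derivative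
`fderiv ℝ (fderiv ℝ V) δ₀`; with the remaining letters of `isLittleO_constrValue_hessian`:
`(h ↦ φ (w₀ + h) − φ w₀ − DV(δ₀)(N h) − ½ D²V(δ₀)[N h, N h]) =o[𝓝 0] ‖h‖²`. [folklore] -/
theorem isLittleO_constrValue_hessian_of_contDiffAt {V : E → ℝ} {D : E →L[ℝ] F} {N : F →L[ℝ] E} (hN : ∀ w, D (N w) = w)
    {δ₀ : E} (hV : ContDiffAt ℝ 2 V δ₀)
    (hNmin : ∀ v, fderiv ℝ (fderiv ℝ V) δ₀ (N (D v)) (N (D v)) ≤ fderiv ℝ (fderiv ℝ V) δ₀ v v) {w₀ : F}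
    (hδ₀ : D δ₀ = w₀) (hmin : ∀ δ, D δ = w₀ → V δ₀ ≤ V δ) {m : ℝ} (hm : 0 < m)
    (hfo : ∀ δ, V δ₀ + fderiv ℝ V δ₀ (δ - δ₀) + m / 2 * ‖δ - δ₀‖ ^ 2 ≤ V δ) (hpsd : ∀ v, 0 ≤ fderiv ℝ (fderiv ℝ V) δ₀ v v) :
    (fun h => (⨅ δ : {δ // D δ = w₀ + h}, V δ.1) - (⨅ δ : {δ // D δ = w₀}, V δ.1) - fderiv ℝ V δ₀ (N h)
        - fderiv ℝ (fderiv ℝ V) δ₀ (N h) (N h) / 2) =o[𝓝 (0 : F)] fun h => ‖h‖ ^ 2 := by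
  have h1 : ∀ᶠ δ in 𝓝 δ₀, HasFDerivAt V (fderiv ℝ V δ) δ :=
    (hV.eventually (by simp)).mono fun δ hδ => (hδ.differentiableAt (by simp)).hasFDerivAt
  have h2 : HasFDerivAt (fderiv ℝ V) (fderiv ℝ (fderiv ℝ V) δ₀) δ₀ :=
    ((hV.fderiv_right (m := 1) (by norm_num)).differentiableAt one_ne_zero).hasFDerivAt
  exact isLittleO_constrValue_hessian hN hNmin hδ₀ hmin hm hfo hpsd h1 h2

end Hessian

/-! ## §4 Two letters of the NONLINEAR companion `…ConstrainedValueLagrangian` (CVL), discharged: the «multiplier × curvature»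
bound from print's norm bound (135), and the Lagrange condition from the constraint-adapted strong letter (Fermat) -/

section LagrangeLetters

variable {E F : Type*} [NormedAddCommGroup E] [NormedSpace ℝ E] [NormedAddCommGroup F] [NormedSpace ℝ F]

/-- **THE CURVATURE LETTER FROM A NORM BOUND (T-85 (L3) in print's shape).**  `‖G (δ₀ + v) − G δ₀ − T v‖ ≤ C₂‖v‖²` (print's (135)
`|C_k(U₀, A)| ≤ C₂|A|²`) ⟹ `|Λ (G (δ₀ + v) − G δ₀ − T v)| ≤ ‖Λ‖C₂‖v‖²` — CVL's global letter `hcurv` with `ρ = ‖Λ‖C₂`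
(print: `‖Λ‖ ≤ B₀‖J‖`, «small because `J` is small»). [folklore] -/
theorem abs_apply_remainder_le {G : E → F} {T : E →L[ℝ] F} (Λ : F →L[ℝ] ℝ) {δ₀ : E} {C₂ : ℝ}
    (hC : ∀ v, ‖G (δ₀ + v) - G δ₀ - T v‖ ≤ C₂ * ‖v‖ ^ 2) (v : E) :
    |Λ (G (δ₀ + v) - G δ₀ - T v)| ≤ ‖Λ‖ * C₂ * ‖v‖ ^ 2 := by
  rw [← Real.norm_eq_abs, mul_assoc]
  exact (Λ.le_opNorm _).trans (mul_le_mul_of_nonneg_left (hC v) (norm_nonneg _))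

omit [NormedSpace ℝ E] in
/-- `‖·‖²` is differentiable at `0` with derivative `0` in any real normed group: `(w ↦ c‖w‖²) = o(w)` at `0`. [folklore] -/
theorem isLittleO_const_mul_norm_sq (c : ℝ) : (fun w : E => c * ‖w‖ ^ 2) =o[𝓝 (0 : E)] fun w => w := by
  have hsq : (fun w : E => ‖w‖ ^ 2) =o[𝓝 (0 : E)] fun w => w := by
    refine isLittleO_iff.2 fun ε hε => Metric.eventually_nhds_iff.2 ⟨ε, hε, fun w hw => ?_⟩
    rw [dist_zero_right] at hw
    rw [Real.norm_of_nonneg (by positivity), sq]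
    exact mul_le_mul_of_nonneg_right hw.le (norm_nonneg _)
  simpa using hsq.const_mul_left c

/-- **THE LAGRANGE CONDITION IS AUTOMATIC** (CVL's INFO ι-CVL-1 discharged): the constraint-adapted strong letter
`V δ₀ + Λ (G δ − G δ₀) + μ‖δ − δ₀‖² ≤ V δ` (any real `μ`), `HasFDerivAt V V′ δ₀` and `HasFDerivAt G T δ₀` ⟹ `V′ = Λ ∘ T`: the function
`w ↦ V (δ₀ + w) − Λ (G (δ₀ + w) − G δ₀) − μ‖w‖²` is `≥ V δ₀` everywhere with equality at `0` and has derivative `V′ − Λ ∘ T` there, so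
Fermat (`IsLocalMin.hasFDerivAt_eq_zero`) kills it. [folklore] -/
theorem apply_eq_apply_comp_of_firstOrderG {V : E → ℝ} {G : E → F} {V' : E →L[ℝ] ℝ} {Λ : F →L[ℝ] ℝ} {T : E →L[ℝ] F} {δ₀ : E}
    {μ : ℝ} (hfoG : ∀ δ, V δ₀ + Λ (G δ - G δ₀) + μ * ‖δ - δ₀‖ ^ 2 ≤ V δ) (hV : HasFDerivAt V V' δ₀) (hT : HasFDerivAt G T δ₀)
    (v : E) : V' v = Λ (T v) := by
  have hadd : HasFDerivAt (fun w : E => δ₀ + w) (ContinuousLinearMap.id ℝ E) 0 := (hasFDerivAt_id (0 : E)).const_add δ₀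
  have hV0 : HasFDerivAt (fun w : E => V (δ₀ + w)) (V'.comp (ContinuousLinearMap.id ℝ E)) 0 :=
    (show HasFDerivAt V V' (δ₀ + 0) by simpa using hV).comp (0 : E) hadd
  have hG0 : HasFDerivAt (fun w : E => G (δ₀ + w)) (T.comp (ContinuousLinearMap.id ℝ E)) 0 :=
    (show HasFDerivAt G T (δ₀ + 0) by simpa using hT).comp (0 : E) hadd
  have hΛG : HasFDerivAt (fun w : E => Λ (G (δ₀ + w) - G δ₀)) (Λ.comp (T.comp (ContinuousLinearMap.id ℝ E))) 0 :=
    Λ.hasFDerivAt.comp (0 : E) (hG0.sub_const (G δ₀))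
  have hsq : HasFDerivAt (fun w : E => μ * ‖w‖ ^ 2) (0 : E →L[ℝ] ℝ) 0 := by
    rw [hasFDerivAt_iff_isLittleO_nhds_zero]
    simpa using isLittleO_const_mul_norm_sq (E := E) μ
  have hφ : HasFDerivAt (fun w : E => V (δ₀ + w) - Λ (G (δ₀ + w) - G δ₀) - μ * ‖w‖ ^ 2)
      (V'.comp (ContinuousLinearMap.id ℝ E) - Λ.comp (T.comp (ContinuousLinearMap.id ℝ E)) - 0) 0 := (hV0.sub hΛG).sub hsq
  have hmin : IsLocalMin (fun w : E => V (δ₀ + w) - Λ (G (δ₀ + w) - G δ₀) - μ * ‖w‖ ^ 2) 0 :=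
    Filter.Eventually.of_forall fun w => by
      have h1 := hfoG (δ₀ + w)
      rw [add_sub_cancel_left] at h1
      simp only [add_zero, sub_self, map_zero, norm_zero]
      nlinarith [h1]
  have hzero := hmin.hasFDerivAt_eq_zero hφ
  have h := congrArg (fun L : E →L[ℝ] ℝ => L v) hzero
  simp only [sub_apply, ContinuousLinearMap.comp_apply, ContinuousLinearMap.id_apply, zero_apply, sub_zero] at h
  linarith

end LagrangeLetters

end Summit.QuantumFields.BalabanUV.T4Continuum.NE7b.ConstrainedValueHessian
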